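import Literature.NumberTheory.EllipticCurves.PAdicLFunctionIntegralityAtTwoAutoProofs
import Literature.NumberTheory.EllipticCurves.PAdicBSDInterpolationProofs
import Literature.NumberTheory.EllipticCurves.PAdicBSDProofs
import HarnessLib

/-!
# `L₂(f, α, T) = 2 · (unit of Λ)` from odd half-integral steps of the plus modular symbol along
# `b/2^m` (proofs only; the `λ = μ = 0` certificate shape at `p = 2`, `a₂ = −1`)

A *proofs* file (theorems only: no definition, no named fact; D-0014/D-0026), a sharpening of
`PAdicLFunctionIntegralityAtTwoAutoProofs` (INT2-AUTO: every coefficient of the tree's `2`-adic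
`L`-function `padicLFunction f α` of a rational newform of odd level, `α` the unit root, lies in
`ℤ₂`). Here, for a curve `E = W/ℚ` good ordinary at `2` with `a₂(E) = −1` (so `α² + α + 2 = 0`) and
its newform `f`, we prove: IF the plus modular symbol `[x]⁺_f = ratPlusSymbol f x` satisfies

* (H0) `[0]⁺_f = u/8` with `u` odd, and
* (HD) for every `m ≥ 1` and every odd `b`: `[b/2^{m+1}]⁺_f − [b/2^m]⁺_f = k/2` with `k` ODD,

THEN `L₂(f, α, T) = 2 · ι(L₀)` for a UNIT `L₀ ∈ Λ = ℤ₂⟦T⟧` (`ι : Λ ↪ ℚ₂⟦T⟧`), i.e. in the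
`f`-normalisation `μ(L₂) = 1` and `λ(L₂) = 0` (`exists_isUnit_iwasawaToPowerSeries_eq_half_padicLFunction_two`).

THE ARGUMENT (elementary `2`-adic arithmetic on the Mazur–Tate–Teitelbaum measure, MTT 1986 §I.10
(10.1), §I.13; the level-`15` instance is the computation of cell bsd-rank2, lit GEN 16,
`run/shared/lean/pub/bsd-rank2/lit/g16/X2d-lambda-level15.md`):
1. (`norm_msdMeasure_two_le_one_of_oddHalfSteps`) for `m ≥ 1` and an ODD residue `a mod 2^{m+1}`:
   `μ_{f,α}(a + 2^{m+1}ℤ₂) = α^{−(m+1)}[a/2^{m+1}]⁺ − α^{−(m+2)}[a/2^m]⁺ = α^{−(m+2)}·Y`,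
   `Y = (α − 1)s + αk/2`, `s = [a/2^m]⁺ = u/8 + j/2` (Manin: `exists_ratPlusSymbol_eq_add_div_two`),
   `k` odd by (HD); with `u = k − 2e` the identity `8Y(α + 2) = 4k(α − 1) + 8(e − k − 2j)` and
   `(α − 1)(α + 2) = −4` (so `‖α + 2‖₂ = 1`, `‖α − 1‖₂ = 1/4`) give `‖Y‖₂ ≤ 1`, i.e. `μ ∈ ℤ₂`
   (INT2-AUTO only gives `‖μ‖₂ ≤ 2`);
2. (`norm_padicLCoeff_two_le_half_of_oddHalfSteps`) the Riemann sums of the `k`-th coefficient are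
   `2 · Σ_s μ(5ˢ + 2ⁿ⁺²ℤ₂)·C(s,k)` (`padicLRiemannSum_two`, the `Δ = {±1}` doubling), the residues
   `5ˢ` are odd, so every Riemann sum and hence every coefficient has norm `≤ 1/2`;
3. (`exists_isUnit_iwasawaToPowerSeries_eq_half_padicLFunction_two`) hence `½·L₂(f, α, T) = ι(L₀)`,
   `L₀ ∈ Λ` (`exists_iwasawaToPowerSeries_eq_iff_norm_coeff_le_one`), and its constant term
   `½(1 − α⁻¹)²[0]⁺_f = (α − 1)²u/(16α²)` (`constantCoeff_padicLFunction_unitRoot`, MTT (14.3)) has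
   norm `(1/16)·8·2 = 1`: `L₀` is a unit of `Λ` (`PowerSeries.isUnit_iff_constantCoeff`).
Nothing is asserted about any particular curve: (H0) and (HD) are HYPOTHESES (for the conductor-`15`
newform they are the exact modular-symbol law certified by kit jobs j272806/j272821 of the cell memo:
`[0]⁺ = 1/8`, `[b/d]⁺ − [0]⁺ ≡ ½·[(d/5) = −1] (mod ℤ)` on Γ₀(15), whence `k(b/2^m) ≡ m (mod 2)`).
Consumer: the `λ`-clause «`∃ c L₀, L₀ ≠ 0 ∧ ι L₀ = C c · L₂(f, α) ∧ lam L₀ = 0`» of cell bsd-rank2's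
`LambdaZeroAtFifteen` (T-r3₂ equality door), via `isUnit_iff_mu_eq_zero_and_lam_eq_zero`
(Summits-side `Rank1Residual.X1.MuLambda`). Only `a₂ = −1` is treated.
-- TODO(general form): `a₂ = +1` (`α² − α + 2 = 0`, `‖α − 1‖₂ = 1/2`) needs a different bookkeeping.

## References

* B. Mazur, J. Tate, J. Teitelbaum, *On `p`-adic analogues of the conjectures of Birch and
  Swinnerton-Dyer*, Invent. Math. 84 (1986), §I.10 (10.1), §I.13, §I.14 (14.3).
  [MazurTateTeitelbaum1986Invent]
* J. E. Cremona, *Algorithms for modular elliptic curves*, 2nd ed. (1997), §2.8 (Manin's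
  `{∞, x} − {∞, 0} ∈ Λ_f`). [CremonaAlgorithms1997]
-/

noncomputable section

open Filter Topology

open scoped MatrixGroups

open CongruenceSubgroup Literature.NumberTheory.EllipticCurves.ModularForms

namespace Literature.NumberTheory.EllipticCurves

/-! ### §1. `2`-adic norms around the unit root of `X² + X + 2` -/

section Norms

/-- `‖2‖₂ = 1/2`. [folklore] -/
private theorem norm_two : ‖(2 : ℚ_[2])‖ = (2 : ℝ)⁻¹ := by
  have h := Padic.norm_p (p := 2)
  simpa using h

/-- `‖4‖₂ = 1/4`. [folklore] -/
private theorem norm_four : ‖(4 : ℚ_[2])‖ = (4 : ℝ)⁻¹ := by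
  rw [show (4 : ℚ_[2]) = 2 * 2 by norm_num, norm_mul, norm_two]; norm_num

/-- `‖8‖₂ = 1/8`. [folklore] -/
private theorem norm_eight : ‖(8 : ℚ_[2])‖ = (8 : ℝ)⁻¹ := by
  rw [show (8 : ℚ_[2]) = 2 * 2 * 2 by norm_num, norm_mul, norm_mul, norm_two]; norm_num

/-- `‖z‖₂ ≤ 1` for an integer `z`. [folklore] -/
private theorem norm_intCast_le (z : ℤ) : ‖(z : ℚ_[2])‖ ≤ 1 := Padic.norm_int_le_one z

/-- An odd integer is a `2`-adic unit: `‖u‖₂ = 1`. [folklore] -/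
private theorem norm_intCast_eq_one_of_odd {u : ℤ} (hu : Odd u) : ‖(u : ℚ_[2])‖ = 1 := by
  refine le_antisymm (norm_intCast_le u) (le_of_not_gt fun h ↦ ?_)
  rw [Padic.norm_intCast_lt_one_iff] at h
  exact (Int.not_even_iff_odd.mpr hu) (even_iff_two_dvd.mpr (by exact_mod_cast h))

/-- For a `2`-adic unit `α` with `α² + α + 2 = 0` (the unit root at a good ordinary `2` with
`a₂ = −1`): `α ≠ 0`, `‖α + 2‖₂ = 1` and `‖α − 1‖₂ = 1/4` (from `(α − 1)(α + 2) = −4`). [folklore] -/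
private theorem norm_add_two_and_norm_sub_one_of_unitRoot_neg_one {α : ℚ_[2]} (hαu : ‖α‖ = 1)
    (hroot : α ^ 2 + α + 2 = 0) : α ≠ 0 ∧ ‖α + 2‖ = 1 ∧ ‖α - 1‖ = (4 : ℝ)⁻¹ := by
  have hα0 : α ≠ 0 := by rintro rfl; norm_num at hroot
  have h2 : ‖α + 2‖ = 1 := by
    have hne : ‖α‖ ≠ ‖(2 : ℚ_[2])‖ := by rw [hαu, norm_two]; norm_num
    rw [Padic.add_eq_max_of_ne hne, hαu, norm_two]
    norm_num
  refine ⟨hα0, h2, ?_⟩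
  have hprod : (α - 1) * (α + 2) = -4 := by linear_combination hroot
  have h := congrArg (‖·‖) hprod
  simp only [norm_mul, h2, mul_one, norm_neg] at h
  rw [h, norm_four]

end Norms

/-! ### §2. The measure bound `μ_{f,α}(a + 2^{m+1}ℤ₂) ∈ ℤ₂` at odd residues, `m ≥ 1` -/

section Measure

variable {N : ℕ} [NeZero N] (f : CuspForm (Gamma0 N) 2)

/-- **`‖μ_{f,α}(a + 2^{m+1}ℤ₂)‖₂ ≤ 1` for `m ≥ 1` and `a` odd**, for a cusp form with real
coefficients of odd level, `α` a `2`-adic unit with `α² + α + 2 = 0`, under (H0) `[0]⁺ = u/8`, `u`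
odd, and (HD) `[b/2^{m+1}]⁺ − [b/2^m]⁺ ∈ ½ + ℤ` for `m ≥ 1`, `b` odd. With `s = [a/2^m]⁺ = u/8 + j/2`
(Manin) and `[a/2^{m+1}]⁺ = s + k/2`, `k` odd: `μ = α^{−(m+2)}((α − 1)s + αk/2)` and
`8((α − 1)s + αk/2)(α + 2) = 4k(α − 1) + 8(e − k − 2j)` where `u = k − 2e`, a quantity of norm
`≤ 1/8`. [cite: MazurTateTeitelbaum1986Invent, §I.10 (10.1)] [cite: CremonaAlgorithms1997, §2.8] -/
theorem norm_msdMeasure_two_le_one_of_oddHalfSteps (hreal : ∀ n, (cuspCoeff f n).im = 0)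
    (h2N : ¬ 2 ∣ N) {α : ℚ_[2]} (hαu : ‖α‖ = 1) (hroot : α ^ 2 + α + 2 = 0)
    (h0 : ∃ u : ℤ, Odd u ∧ ratPlusSymbol f 0 = (u : ℚ) / 8)
    (hstep : ∀ m b : ℕ, 1 ≤ m → Odd b → ∃ k : ℤ, Odd k ∧
      ratPlusSymbol f ((b : ℚ) / 2 ^ (m + 1)) - ratPlusSymbol f ((b : ℚ) / 2 ^ m) = (k : ℚ) / 2)
    {m : ℕ} (hm : 1 ≤ m) (a : ZMod (2 ^ (m + 1))) (ha : Odd a.val) :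
    ‖msdMeasure f α (m + 1) a‖ ≤ 1 := by
  obtain ⟨hα0, hα2, hα1⟩ := norm_add_two_and_norm_sub_one_of_unitRoot_neg_one hαu hroot
  obtain ⟨u, hu, hu0⟩ := h0
  obtain ⟨k, hk, hk1⟩ := hstep m a.val hm ha
  obtain ⟨j, hj⟩ := exists_ratPlusSymbol_eq_add_div_two f hreal
    (coprime_den_div_prime_pow (p := 2) h2N a.val m)
  obtain ⟨e, he⟩ : ∃ e : ℤ, k - u = 2 * e := by
    obtain ⟨e, he⟩ := (hk.sub_odd hu)
    exact ⟨e, by rw [he]; ring⟩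
  -- the two symbols in terms of `u, j, k`
  set s : ℚ := ratPlusSymbol f ((a.val : ℚ) / 2 ^ m) with hs
  have hs' : s = (u : ℚ) / 8 + (j : ℚ) / 2 := by
    rw [hs]
    have h := hj
    rw [hu0] at h
    push_cast at h ⊢
    rw [h]
  have hs1 : ratPlusSymbol f ((a.val : ℚ) / 2 ^ (m + 1)) = s + (k : ℚ) / 2 := by
    rw [hs]; linarith
  simp only [msdMeasure]
  have hcast : ((2 : ℕ) : ℚ) = (2 : ℚ) := by norm_num
  rw [hcast, hs1, ← hs, hs']
  push_cast
  -- `μ = α⁻¹^(m+2) · Y`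
  set Y : ℚ_[2] := (α - 1) * ((u : ℚ_[2]) / 8 + (j : ℚ_[2]) / 2) + α * ((k : ℚ_[2]) / 2) with hY
  have hμ : α⁻¹ ^ (m + 1) * ((u : ℚ_[2]) / 8 + (j : ℚ_[2]) / 2 + (k : ℚ_[2]) / 2) -
      α⁻¹ ^ (m + 2) * ((u : ℚ_[2]) / 8 + (j : ℚ_[2]) / 2) = α⁻¹ ^ (m + 2) * Y := by
    have hαα : α⁻¹ ^ (m + 2) * α = α⁻¹ ^ (m + 1) := by
      rw [pow_succ, mul_assoc, inv_mul_cancel₀ hα0, mul_one]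
    rw [hY, ← hαα]
    ring
  rw [hμ, norm_mul, norm_pow, norm_inv, hαu, inv_one, one_pow, one_mul]
  -- `‖Y‖ ≤ 1` from `8 Y (α + 2) = 4 k (α - 1) + 8 (e - k - 2 j)`
  have hue : (u : ℚ_[2]) = (k : ℚ_[2]) - 2 * (e : ℚ_[2]) := by
    have h := congrArg (fun z : ℤ ↦ (z : ℚ_[2])) he
    push_cast at h
    linear_combination -h
  have hid : 8 * Y * (α + 2) = 4 * (k : ℚ_[2]) * (α - 1) +
      8 * ((e : ℚ_[2]) - (k : ℚ_[2]) - 2 * (j : ℚ_[2])) := by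
    rw [hY, hue]
    linear_combination ((k : ℚ_[2]) - 2 * (e : ℚ_[2]) + 4 * (j : ℚ_[2]) + 4 * (k : ℚ_[2])) * hroot
  have hA : ‖4 * (k : ℚ_[2]) * (α - 1)‖ ≤ (8 : ℝ)⁻¹ := by
    rw [norm_mul, norm_mul, norm_four, hα1]
    calc (4 : ℝ)⁻¹ * ‖(k : ℚ_[2])‖ * 4⁻¹ ≤ 4⁻¹ * 1 * 4⁻¹ := by
          gcongr; exact norm_intCast_le k
      _ ≤ 8⁻¹ := by norm_num
  have hB : ‖8 * ((e : ℚ_[2]) - (k : ℚ_[2]) - 2 * (j : ℚ_[2]))‖ ≤ (8 : ℝ)⁻¹ := by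
    rw [norm_mul, norm_eight]
    have h : ‖(e : ℚ_[2]) - (k : ℚ_[2]) - 2 * (j : ℚ_[2])‖ ≤ 1 := by
      have := norm_intCast_le (e - k - 2 * j)
      push_cast at this
      exact this
    calc (8 : ℝ)⁻¹ * _ ≤ 8⁻¹ * 1 := by gcongr
      _ = 8⁻¹ := mul_one _
  have h8Y : ‖8 * Y * (α + 2)‖ ≤ (8 : ℝ)⁻¹ := by
    rw [hid]
    exact (Padic.nonarchimedean _ _).trans (max_le hA hB)
  rw [norm_mul, norm_mul, norm_eight, hα2, mul_one] at h8Y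
  exact le_of_not_gt fun h ↦ by
    have : (8 : ℝ)⁻¹ * 1 < 8⁻¹ * ‖Y‖ := by gcongr
    linarith

/-- The residues `5ˢ mod 2ⁿ⁺²` (the `Γ`-part of `ℤ₂^×`, `γ = 5`) are odd. [folklore] -/
private theorem odd_val_cyclotomicGenerator_pow (n s : ℕ) :
    Odd ((cyclotomicGenerator 2 : ZMod (2 ^ (n + 2))) ^ s).val := by
  have h5 : (cyclotomicGenerator 2 : ZMod (2 ^ (n + 2))) ^ s = ((5 ^ s : ℕ) : ZMod (2 ^ (n + 2))) := by
    simp [cyclotomicGenerator, cyclotomicExponent]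
  rw [h5, ZMod.val_natCast, Nat.odd_iff, Nat.mod_mod_of_dvd _ (dvd_pow_self 2 (by omega))]
  exact Nat.odd_iff.mp (Odd.pow (by decide))

/-- **`‖[Tᵏ] L₂(f, α, T)‖₂ ≤ 1/2` for every `k`** under (H0), (HD), for a newform of odd level with
real coefficients, `a₂ = −1`, `α` the unit root (`α² + α + 2 = 0`, `‖α‖₂ = 1`), granted the
distribution relation (`hdist`): each Riemann sum is `2 ×` a sum of values `μ(5ˢ + 2ⁿ⁺²ℤ₂)·C(s,k)`
of norm `≤ 1` (`padicLRiemannSum_two`, `norm_msdMeasure_two_le_one_of_oddHalfSteps` at the odd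
residues `5ˢ`), and the sums converge to the coefficient (`tendsto_padicLRiemannSum_of_norm_le`, with
INT2-AUTO's uniform bound `2`). [cite: MazurTateTeitelbaum1986Invent, §I.13] -/
theorem norm_padicLCoeff_two_le_half_of_oddHalfSteps {f : CuspForm (Gamma0 N) 2}
    (hf : IsNewform0 f) (hreal : ∀ n, (cuspCoeff f n).im = 0) (h2N : ¬ 2 ∣ N)
    (ha₂ : cuspCoeff f 2 = ((-1 : ℤ) : ℂ)) {α : ℚ_[2]} (hαu : ‖α‖ = 1) (hroot : α ^ 2 + α + 2 = 0)
    (h0 : ∃ u : ℤ, Odd u ∧ ratPlusSymbol f 0 = (u : ℚ) / 8)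
    (hstep : ∀ m b : ℕ, 1 ≤ m → Odd b → ∃ k : ℤ, Odd k ∧
      ratPlusSymbol f ((b : ℚ) / 2 ^ (m + 1)) - ratPlusSymbol f ((b : ℚ) / 2 ^ m) = (k : ℚ) / 2)
    (hdist : ∀ (n : ℕ) (a : ZMod (2 ^ n)),
      ∑ b ∈ Finset.univ.filter (fun b : ZMod (2 ^ (n + 1)) ↦
        ZMod.castHom (pow_dvd_pow 2 n.le_succ) (ZMod (2 ^ n)) b = a), msdMeasure f α (n + 1) b =
        msdMeasure f α n a)
    (k : ℕ) : ‖padicLCoeff f α k‖ ≤ (2 : ℝ)⁻¹ := by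
  have hα0 : α ≠ 0 := (norm_add_two_and_norm_sub_one_of_unitRoot_neg_one hαu hroot).1
  have hαi : ‖α⁻¹‖ ≤ 1 := by rw [norm_inv, hαu, inv_one]
  have hroot' : α ^ 2 - ((-1 : ℤ) : ℚ_[2]) * α + 2 = 0 := by push_cast; linear_combination hroot
  -- INT2-AUTO's uniform bound (for convergence only)
  have hμ2 := norm_msdMeasure_two_le_two_auto hf hreal h2N ha₂ hαi hroot'
  have hRS : ∀ n, ‖padicLRiemannSum f α k n‖ ≤ (2 : ℝ)⁻¹ := by
    intro n
    rw [padicLRiemannSum_two]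
    have hS : ‖∑ s : ZMod (2 ^ n),
        msdMeasure f α (n + 2) ((cyclotomicGenerator 2 : ZMod (2 ^ (n + 2))) ^ s.val) *
          (s.val.choose k : ℚ_[2])‖ ≤ 1 := by
      refine IsUltrametricDist.norm_sum_le_of_forall_le_of_nonneg zero_le_one fun s _ ↦ ?_
      have hc : ‖((s.val.choose k : ℕ) : ℚ_[2])‖ ≤ 1 := by
        have h := Padic.norm_int_le_one (p := 2) ((s.val.choose k : ℕ) : ℤ)
        rwa [Int.cast_natCast] at h
      have hμ1 : ‖msdMeasure f α (n + 2)
          ((cyclotomicGenerator 2 : ZMod (2 ^ (n + 2))) ^ s.val)‖ ≤ 1 :=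
        norm_msdMeasure_two_le_one_of_oddHalfSteps f hreal h2N hαu hroot h0 hstep
          (m := n + 1) (by omega) _ (odd_val_cyclotomicGenerator_pow n s.val)
      rw [norm_mul]
      calc _ ≤ 1 * 1 := mul_le_mul hμ1 hc (norm_nonneg _) zero_le_one
        _ = 1 := mul_one _
    rw [norm_mul, norm_two]
    calc (2 : ℝ)⁻¹ * _ ≤ (2 : ℝ)⁻¹ * 1 := by gcongr
      _ = 2⁻¹ := mul_one _
  exact le_of_tendsto (tendsto_padicLRiemannSum_of_norm_le hdist ⟨2, hμ2⟩ k).norm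
    (Eventually.of_forall hRS)

end Measure

/-! ### §3. For `E = W/ℚ` good ordinary at `2` with `a₂ = −1`: `L₂(E, T) = 2 · (unit of Λ)` -/

section Curve

variable {N : ℕ} [NeZero N] {f : CuspForm (Gamma0 N) 2}
  {W : WeierstrassCurve ℚ} [W.IsElliptic] [W.IsGloballyMinimal]

/-- **Every coefficient of `L₂(f, α, T)` lies in `2ℤ₂`** for `E = W/ℚ` globally minimal, good
ordinary at `2` with `a₂(E) = −1`, `f` its newform (any level), `α = unitRoot W 2`, under (H0) and
(HD) on the plus symbols of `f`. Inputs: `unitRoot_coe_spec`, `not_dvd_level_of_isNewformOf`,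
`cuspCoeff_eq_frobeniusTrace_of_isNewformOf_holds`, `msdMeasure_distribution_of_isNewformOf` and §2.
[cite: MazurTateTeitelbaum1986Invent, §I.10–§I.13] -/
theorem norm_padicLCoeff_two_le_half_of_isNewformOf (hord : IsOrdinaryAt W 2)
    (hf : IsNewformOf W f) (ha₂ : W.frobeniusTrace 2 = -1)
    (h0 : ∃ u : ℤ, Odd u ∧ ratPlusSymbol f 0 = (u : ℚ) / 8)
    (hstep : ∀ m b : ℕ, 1 ≤ m → Odd b → ∃ k : ℤ, Odd k ∧
      ratPlusSymbol f ((b : ℚ) / 2 ^ (m + 1)) - ratPlusSymbol f ((b : ℚ) / 2 ^ m) = (k : ℚ) / 2)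
    (k : ℕ) : ‖padicLCoeff f (unitRoot W 2 : ℚ_[2]) k‖ ≤ (2 : ℝ)⁻¹ := by
  obtain ⟨hαeq, hαu, -⟩ := unitRoot_coe_spec (W := W) hord
  have hpN : ¬ 2 ∣ N := not_dvd_level_of_isNewformOf hf hord.1
  have hap : cuspCoeff f 2 = ((W.frobeniusTrace 2 : ℤ) : ℂ) :=
    cuspCoeff_eq_frobeniusTrace_of_isNewformOf_holds hf hord.1
  rw [ha₂] at hap
  have hroot : (unitRoot W 2 : ℚ_[2]) ^ 2 + (unitRoot W 2 : ℚ_[2]) + 2 = 0 := by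
    rw [ha₂] at hαeq
    push_cast at hαeq
    linear_combination hαeq
  exact norm_padicLCoeff_two_le_half_of_oddHalfSteps hf.1
    (cuspCoeff_im_eq_zero_of_coeffField_eq_bot hf.coeffField_eq_bot) hpN hap hαu hroot h0 hstep
    (msdMeasure_distribution_of_isNewformOf hord hf) k

/-- **`L₂(E, T) = 2 · ι(L₀)` with `L₀` a UNIT of `Λ = ℤ₂⟦T⟧`** (so `μ(L₂) = 1`, `λ(L₂) = 0` in the
`f`-normalisation; `μ = λ = 0` for the integral series `L₀ = ½ L₂`): for `E = W/ℚ` globally minimal,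
good ordinary at `2` with `a₂(E) = −1`, `f` its newform and `α = unitRoot W 2`, under
(H0) `[0]⁺_f = u/8`, `u` odd, and (HD) `[b/2^{m+1}]⁺_f − [b/2^m]⁺_f ∈ ½ + ℤ` (`m ≥ 1`, `b` odd).
Integrality of `½ L₂` coefficientwise (`norm_padicLCoeff_two_le_half_of_isNewformOf`,
`exists_iwasawaToPowerSeries_eq_iff_norm_coeff_le_one`); the constant term
`½ (1 − α⁻¹)² [0]⁺_f` (`constantCoeff_padicLFunction_unitRoot`, MTT (14.3)) has norm
`2 · (1/4)² · 8 = 1` (`‖α − 1‖₂ = 1/4`), so `L₀` is a unit (`PowerSeries.isUnit_iff_constantCoeff`,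
`PadicInt.isUnit_iff`). [cite: MazurTateTeitelbaum1986Invent, §I.13 and §I.14 (14.3)] -/
theorem exists_isUnit_iwasawaToPowerSeries_eq_half_padicLFunction_two (hord : IsOrdinaryAt W 2)
    (hf : IsNewformOf W f) (ha₂ : W.frobeniusTrace 2 = -1)
    (h0 : ∃ u : ℤ, Odd u ∧ ratPlusSymbol f 0 = (u : ℚ) / 8)
    (hstep : ∀ m b : ℕ, 1 ≤ m → Odd b → ∃ k : ℤ, Odd k ∧
      ratPlusSymbol f ((b : ℚ) / 2 ^ (m + 1)) - ratPlusSymbol f ((b : ℚ) / 2 ^ m) = (k : ℚ) / 2) :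
    ∃ L₀ : IwasawaAlgebra 2, IsUnit L₀ ∧
      iwasawaToPowerSeries 2 L₀ =
        PowerSeries.C ((2 : ℚ_[2])⁻¹) * padicLFunction f (unitRoot W 2 : ℚ_[2]) := by
  obtain ⟨hαeq, hαu, hα0⟩ := unitRoot_coe_spec (W := W) hord
  have hroot : (unitRoot W 2 : ℚ_[2]) ^ 2 + (unitRoot W 2 : ℚ_[2]) + 2 = 0 := by
    rw [ha₂] at hαeq
    push_cast at hαeq
    linear_combination hαeq
  set α : ℚ_[2] := (unitRoot W 2 : ℚ_[2]) with hαdef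
  -- integrality of `½ L₂`
  have hcoeff : ∀ k : ℕ, ‖PowerSeries.coeff k
      (PowerSeries.C ((2 : ℚ_[2])⁻¹) * padicLFunction f α)‖ ≤ 1 := by
    intro k
    rw [PowerSeries.coeff_C_mul, coeff_padicLFunction, norm_mul, norm_inv, norm_two, inv_inv]
    calc (2 : ℝ) * _ ≤ 2 * 2⁻¹ := by
          gcongr; exact norm_padicLCoeff_two_le_half_of_isNewformOf hord hf ha₂ h0 hstep k
      _ = 1 := by norm_num
  obtain ⟨L₀, hL₀⟩ := (exists_iwasawaToPowerSeries_eq_iff_norm_coeff_le_one _).mpr hcoeff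
  refine ⟨L₀, ?_, hL₀⟩
  -- the constant term of `L₀` is a `2`-adic unit
  obtain ⟨-, hα2, hα1⟩ := norm_add_two_and_norm_sub_one_of_unitRoot_neg_one hαu hroot
  obtain ⟨u, hu, hu0⟩ := h0
  have hc : ((PowerSeries.constantCoeff L₀ : ℤ_[2]) : ℚ_[2]) =
      (2 : ℚ_[2])⁻¹ * ((1 - α⁻¹) ^ 2 * ((ratPlusSymbol f 0 : ℚ) : ℚ_[2])) := by
    have h := congrArg PowerSeries.constantCoeff hL₀
    rw [← PowerSeries.coeff_zero_eq_constantCoeff_apply, PowerSeries.coeff_map,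
      PowerSeries.coeff_zero_eq_constantCoeff_apply, map_mul, PowerSeries.constantCoeff_C,
      hαdef, constantCoeff_padicLFunction_unitRoot hord hf] at h
    exact h
  have hnorm : ‖((PowerSeries.constantCoeff L₀ : ℤ_[2]) : ℚ_[2])‖ = 1 := by
    rw [hc, hu0]
    push_cast
    have h1 : (1 - α⁻¹) = (α - 1) * α⁻¹ := by field_simp
    rw [h1]
    simp only [norm_mul, norm_pow, norm_inv, norm_div, hαu, hα1, norm_two, norm_eight,
      norm_intCast_eq_one_of_odd hu]
    norm_num
  have hunit : IsUnit (PowerSeries.constantCoeff L₀) := PadicInt.isUnit_iff.mpr hnorm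
  exact PowerSeries.isUnit_iff_constantCoeff.mpr hunit

/-- Same, in the shape `L₂(f, α, T) = 2 · ι(L₀)`, `L₀ ∈ Λ^×`.
[cite: MazurTateTeitelbaum1986Invent, §I.13 and §I.14 (14.3)] -/
theorem exists_isUnit_padicLFunction_two_eq_two_mul (hord : IsOrdinaryAt W 2)
    (hf : IsNewformOf W f) (ha₂ : W.frobeniusTrace 2 = -1)
    (h0 : ∃ u : ℤ, Odd u ∧ ratPlusSymbol f 0 = (u : ℚ) / 8)
    (hstep : ∀ m b : ℕ, 1 ≤ m → Odd b → ∃ k : ℤ, Odd k ∧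
      ratPlusSymbol f ((b : ℚ) / 2 ^ (m + 1)) - ratPlusSymbol f ((b : ℚ) / 2 ^ m) = (k : ℚ) / 2) :
    ∃ L₀ : IwasawaAlgebra 2, IsUnit L₀ ∧
      padicLFunction f (unitRoot W 2 : ℚ_[2]) = PowerSeries.C (2 : ℚ_[2]) * iwasawaToPowerSeries 2 L₀ := by
  obtain ⟨L₀, hU, hL₀⟩ :=
    exists_isUnit_iwasawaToPowerSeries_eq_half_padicLFunction_two hord hf ha₂ h0 hstep
  refine ⟨L₀, hU, ?_⟩
  rw [hL₀, ← mul_assoc, ← map_mul, mul_inv_cancel₀ (two_ne_zero), map_one, one_mul]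

/-- The `λ`-clause shape of cell bsd-rank2's `LambdaZeroAtFifteen` (conjunct (d)), Literature side:
`∃ c L₀, L₀ ≠ 0 ∧ ι L₀ = C c · L₂(f, α) ∧ IsUnit L₀` with `c = ½` (a unit has `λ = μ = 0`; the
Summits-side `lam L₀ = 0` follows from `isUnit_iff_mu_eq_zero_and_lam_eq_zero`).
[cite: MazurTateTeitelbaum1986Invent, §I.13 and §I.14 (14.3)] -/
theorem exists_ratCast_isUnit_iwasawaToPowerSeries_eq_padicLFunction_two (hord : IsOrdinaryAt W 2)
    (hf : IsNewformOf W f) (ha₂ : W.frobeniusTrace 2 = -1)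
    (h0 : ∃ u : ℤ, Odd u ∧ ratPlusSymbol f 0 = (u : ℚ) / 8)
    (hstep : ∀ m b : ℕ, 1 ≤ m → Odd b → ∃ k : ℤ, Odd k ∧
      ratPlusSymbol f ((b : ℚ) / 2 ^ (m + 1)) - ratPlusSymbol f ((b : ℚ) / 2 ^ m) = (k : ℚ) / 2) :
    ∃ (c : ℚ) (L₀ : IwasawaAlgebra 2), L₀ ≠ 0 ∧
      iwasawaToPowerSeries 2 L₀ =
        PowerSeries.C ((c : ℚ) : ℚ_[2]) * padicLFunction f (unitRoot W 2 : ℚ_[2]) ∧ IsUnit L₀ := by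
  obtain ⟨L₀, hU, hL₀⟩ :=
    exists_isUnit_iwasawaToPowerSeries_eq_half_padicLFunction_two hord hf ha₂ h0 hstep
  refine ⟨2⁻¹, L₀, hU.ne_zero, ?_, hU⟩
  rw [hL₀]
  push_cast
  rfl

end Curve

end Literature.NumberTheory.EllipticCurves

end
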